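import Mathlib

/-!
# The toric Nash blow-up LOOP of Castillo–Duarte–Leyton-Álvarez–Liendo (2024) — kernel-checked combinatorics, I:
# the cone, Lemma 2, the determinants, and the Nash chart `S_A = U(S)`

`Literature/AlgebraicGeometry/Resolution/NashBlowupToricLoop.lean`.  Source: F. Castillo, D. Duarte,
M. Leyton-Álvarez, A. Liendo, *Nash blowup fails to resolve singularities in dimensions four and higher*,
arXiv:2409.19767 (2024) [cite: CastilloEtAl2024] (held text `paper:arxiv-2409.19767`, pp. 3–6 read on the page).
Their Main Theorem (p. 3): «For every `d ≥ 4` and every algebraically closed field `𝕜`, there exists a normal singular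
affine algebraic variety `X` of dimension `d` over `𝕜` such that: (i) If `char(𝕜) = 0`, then the Nash blowup of `X`
and the normalized Nash blowup of `X` contains an open affine subset isomorphic to `X`. (ii) If `char(𝕜)` is positive
and different from `3`, then the normalized Nash blowup of `X` contains an open affine subset isomorphic to `X`.
(iii) If `char(𝕜) = 3`, then the second iteration of the normalized Nash blowup of `X` contains an open affine subset
isomorphic to `X`. Consequently, in every dimension `d ≥ 4` and every characteristic, iterating the Nash blowup or the
normalized Nash blowup fails to resolve singularities.»  The variety for (i), and for (ii) when `p ∉ {2, 3}`, is the
affine toric fourfold `X(S)`, `S = ω ∩ ℤ⁴`, `ω = cone(h₁, …, h₆) ⊂ ℝ⁴` (p. 5); the proof is a FINITE COMBINATORIAL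
COMPUTATION on top of the combinatorial description of the (normalized) Nash blow-up of a toric variety
(González-Sprinberg; González–Teissier; Duarte–Jeffries–Núñez-Betancourt in characteristic `p`; recalled on p. 4 of
the source): the affine charts of the Nash blow-up of `X(S)` are the `X(S_A)`, `A = {h_{i₁}, …, h_{i_d}} ⊂ 𝓗(S)` with
`det_p(A) ≠ 0`, `S_A` the semigroup generated by `𝓗(S)` and the differences `g − h` (`h ∈ A`, `g ∈ 𝓗(S) ∖ A`,
`det_p(g, A ∖ h) ≠ 0`); the charts of the NORMALIZED Nash blow-up are the `X(S_v)`, `v` a vertex of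
`𝒩_p(S) = conv{h_{i₁} + ⋯ + h_{i_d} : det_p ≠ 0} + ω`, `S_v = cone(𝒩_p(S) − v) ∩ ℤ⁴`.

## What this file PROVES (every statement is a kernel theorem — `decide` for the finite data, short structural
   proofs otherwise; nothing here is a named fact and nothing is asserted about schemes)

* §1 DATA (p. 5): the Hilbert basis `h₁, …, h₇` (`h₇ = (1,2,−1,0)`, `2h₇ = h₂ + h₄ + h₅`), the six facet inequalities
  of `ω` (the rays `(1,0,0,0), (0,1,0,0), (1,0,0,1), (1,0,1,0), (0,1,0,3), (0,2,3,0)` of `σ = ω^∨`), the saturated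
  semigroup `S := ω ∩ ℤ⁴` as an `AddSubmonoid (Fin 4 → ℤ)`, the chart `A = {h₁, h₂, h₃, h₅}`, CDLAL's unimodular
  matrix `U` (p. 5) with its inverse, `U · U⁻¹ = U⁻¹ · U = 1`, `det U = 1`, and the table `U(h₁) = h₆ − h₅, …,
  U(h₇) = h₇ − h₂` of p. 5 verbatim.
* §2 LEMMA 2 (p. 5): `S = ℕ⟨h₁, …, h₇⟩` (`S_eq_closure`), by the octahedron triangulation
  `σ₁ = ⟨h₁h₂h₃h₄⟩, σ₂ = ⟨h₁h₂h₃h₆⟩, σ₃ = ⟨h₁h₂h₅h₆⟩, σ₄ = ⟨h₁h₂h₄h₅⟩` (`det σ₄ = 2`, extra point `h₇`) written as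
  four sign regions with explicit non-negative witnesses.
* §3 DETERMINANTS: `det(h₁h₂h₃h₅) = −1`; the twelve determinants of display (4), p. 5, verbatim; all `|det| ≤ 3`, so
  `det_p = 0 ⟺ det = 0` for `p = 0` and every `p ≥ 5` (source p. 6).
* §4 THE LOOP (`closure_nashChartGens_eq_map`): for `p = 0` or `p ≥ 5` the Nash-chart semigroup
  `S_A = ℕ⟨𝓗(S) ∪ 𝒢_A⟩` (González–Teissier / DJNB generators, `det_p` read in `ZMod p`) IS `U(S)` — «`S_A` is
  isomorphic to `S`» via the lattice automorphism `U`; and `mem_map_U_iff_tau`: `U(S)` is the set of ALL lattice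
  points of the cone `Uω = {x : ⟨τ_j, x⟩ ≥ 0}`, `τ_j = U^{−T} n_j` the six rays `(0,2,1,2), (0,2,0,3), (1,2,2,2),
  (0,1,1,1), (3,2,3,3), (0,1,0,3)` of the normal cone `τ` at the loop vertex — in particular `U(S)` is saturated.
  The NORMALIZED chart at the vertex `v_A = h₁+h₂+h₃+h₅` and the eigen-certificate of the loop direction are in the
  sequel file `NashBlowupToricLoopNormalized.lean`.

## NOT here
The scheme-level dictionary «charts of the (normalized) Nash blow-up of `X(S)` = `X(S_A)` / `X(S_v)`» and the Nash
blow-up itself are NOT formalised (no such toric geometry in Mathlib); they are quoted above and stay on paper — this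
file certifies exactly the finite computation the source performs on top of them.  Minimality of the seven generators
(the «Hilbert basis» half of Lemma 2) is not restated.  The characteristic-`2` cone `ω₂` and the characteristic-`3`
two-step loop (p. 6) are not typed.  Written for the res-hironaka cell (ladder RESOLUTION, slot W4.4, object U1 of
res-L0-w44-plan-1's UNCLAIMED-STUB LIST v2; consulting memo res-L0-w44-tri-2 KC-NASH v1.1 §1–§2, whose exact data this
file re-derives); AI-formalised, weaker than expert review.
-/

namespace Literature.AlgebraicGeometry.Resolution

namespace CDLAL

open Matrix

/-! ## §1 Data (source p. 5) -/

/-- The Hilbert basis `𝓗(S) = {h₁, …, h₇}` of `S = ω ∩ ℤ⁴` (source p. 5, matrix `A` and Lemma 2): `h 0 = h₁ = e₁`,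
`h 1 = h₂ = e₂`, `h 2 = h₃ = e₃`, `h 3 = h₄ = e₄`, `h 4 = h₅ = (2,3,−2,−1)`, `h 5 = h₆ = (1,3,−1,−1)` (the six ray
generators of `ω`) and `h 6 = h₇ = (1,2,−1,0)`.  INDEX SHIFT: `h i` is the paper's `h_{i+1}`. [cite: CastilloEtAl2024, §2 p. 5] -/
def h : Fin 7 → Fin 4 → ℤ :=
  ![![1, 0, 0, 0], ![0, 1, 0, 0], ![0, 0, 1, 0], ![0, 0, 0, 1], ![2, 3, -2, -1], ![1, 3, -1, -1], ![1, 2, -1, 0]]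

/-- `2 h₇ = h₂ + h₄ + h₅` (source p. 5, proof of Lemma 2: «`h₇ = ½h₂ + ½h₄ + ½h₅`»). [cite: CastilloEtAl2024, Lemma 2] -/
theorem two_smul_h6 : 2 • h 6 = h 1 + h 3 + h 4 := by decide

/-- The six facet normals of `ω = cone(h₁,…,h₆)`, i.e. the primitive ray generators of the dual cone `σ = ω^∨`:
`(1,0,0,0), (0,1,0,0), (1,0,0,1), (1,0,1,0), (0,1,0,3), (0,2,3,0)` (computed; each is `≥ 0` on all `hᵢ` and
vanishes on at least three of the rays `h₁…h₆` — `facetNormal_facets`). [folklore] -/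
def facetNormal : Fin 6 → Fin 4 → ℤ :=
  ![![1, 0, 0, 0], ![0, 1, 0, 0], ![1, 0, 0, 1], ![1, 0, 1, 0], ![0, 1, 0, 3], ![0, 2, 3, 0]]

/-- Membership in the cone `ω = cone(h₁,…,h₆)` of the source (p. 5), written by its six facet inequalities. [cite: CastilloEtAl2024, §2 p. 5] -/
def InCone (m : Fin 4 → ℤ) : Prop := ∀ j : Fin 6, 0 ≤ facetNormal j ⬝ᵥ m

/-- The six facet functionals in coordinates: `m = (a,b,c,d) ∈ ω ⟺ a ≥ 0 ∧ b ≥ 0 ∧ a + d ≥ 0 ∧ a + c ≥ 0 ∧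
b + 3d ≥ 0 ∧ 2b + 3c ≥ 0`. [cite: CastilloEtAl2024, §2 p. 5] -/
theorem inCone_iff (m : Fin 4 → ℤ) : InCone m ↔
    0 ≤ m 0 ∧ 0 ≤ m 1 ∧ 0 ≤ m 0 + m 3 ∧ 0 ≤ m 0 + m 2 ∧ 0 ≤ m 1 + 3 * m 3 ∧ 0 ≤ 2 * m 1 + 3 * m 2 := by
  simp only [InCone, Fin.forall_fin_succ, Fin.isValue, facetNormal, dotProduct, Fin.sum_univ_four, cons_val_zero,
    cons_val_one, cons_val_succ, IsEmpty.forall_iff, and_true]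
  simp

/-- Facet/ray incidence of the cone over an octahedron (source p. 5: «`ω` is a cone over a three dimensional
octahedron»): each facet normal is non-negative on the rays `h₁,…,h₆` and vanishes on at least three of them, and each
ray lies on at least three facets. [cite: CastilloEtAl2024, §2 p. 5] -/
theorem facetNormal_facets :
    (∀ j : Fin 6, ∀ i : Fin 6, 0 ≤ facetNormal j ⬝ᵥ h (Fin.castSucc i)) ∧
    (∀ j : Fin 6, 3 ≤ (Finset.univ.filter fun i : Fin 6 => facetNormal j ⬝ᵥ h (Fin.castSucc i) = 0).card) ∧
    (∀ i : Fin 6, 3 ≤ (Finset.univ.filter fun j : Fin 6 => facetNormal j ⬝ᵥ h (Fin.castSucc i) = 0).card) := by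
  decide

/-- `S = ω ∩ ℤ⁴`, the saturated affine semigroup of the toric fourfold `X(S)` (source p. 5: «Let `X(S)` be the toric
variety defined by `S = ω ∩ M`»), as an additive submonoid of `ℤ⁴` cut out by the six facet inequalities. [cite: CastilloEtAl2024, §2 p. 5] -/
def S : AddSubmonoid (Fin 4 → ℤ) where
  carrier := {m | InCone m}
  zero_mem' := fun j => by simp
  add_mem' := fun {a b} ha hb j => by
    rw [dotProduct_add]
    exact add_nonneg (ha j) (hb j)

/-- Membership in `S = ω ∩ M` is the cone condition (source p. 5). [cite: CastilloEtAl2024, §2 p. 5] -/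
theorem mem_S_iff (m : Fin 4 → ℤ) : m ∈ S ↔ InCone m := Iff.rfl

/-- `S` is pointed (`ω` is strongly convex): `m, −m ∈ S ⇒ m = 0` (source p. 5: «Since `S` is pointed, the same holds
for `S_A`»). [cite: CastilloEtAl2024, §2 p. 5] -/
theorem S_pointed (m : Fin 4 → ℤ) (hm : m ∈ S) (hm' : -m ∈ S) : m = 0 := by
  rw [mem_S_iff, inCone_iff] at hm hm'
  simp only [Pi.neg_apply] at hm'
  funext k
  fin_cases k <;> simp <;> omega

/-- The Hilbert basis lies in `S`. [cite: CastilloEtAl2024, Lemma 2] -/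
theorem h_mem_S (g : Fin 7) : h g ∈ S := by
  rw [mem_S_iff]; revert g; unfold InCone; decide

/-- CDLAL's unimodular matrix `U` (source p. 5: «let `U : M → M` be the automorphism of `M = ℤ⁴` given by the
unimodular matrix `U = [[−1,0,−2,1],[0,−1,−3,0],[1,0,2,0],[0,1,2,0]]`»). [cite: CastilloEtAl2024, §2 p. 5] -/
def U : Matrix (Fin 4) (Fin 4) ℤ := !![-1, 0, -2, 1; 0, -1, -3, 0; 1, 0, 2, 0; 0, 1, 2, 0]

/-- The inverse matrix `U⁻¹ = [[0,2,1,2],[0,2,0,3],[0,−1,0,−1],[1,0,1,0]]` of the source's automorphism `U` of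
`M = ℤ⁴` (computed here). [cite: CastilloEtAl2024, §2 p. 5] -/
def Uinv : Matrix (Fin 4) (Fin 4) ℤ := !![0, 2, 1, 2; 0, 2, 0, 3; 0, -1, 0, -1; 1, 0, 1, 0]

/-- `U · U⁻¹ = 1` («`U : M → M` … automorphism of `M = ℤ⁴`», source p. 5). [cite: CastilloEtAl2024, §2 p. 5] -/
theorem U_mul_Uinv : U * Uinv = 1 := by decide

/-- `U⁻¹ · U = 1` («`U : M → M` … automorphism of `M = ℤ⁴`», source p. 5). [cite: CastilloEtAl2024, §2 p. 5] -/
theorem Uinv_mul_U : Uinv * U = 1 := by decide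

/-- `det U = 1` («unimodular», source p. 5). [cite: CastilloEtAl2024, §2 p. 5] -/
theorem det_U : U.det = 1 := by decide

/-- `U (U⁻¹ v) = v` (`U` is an automorphism of `M`, source p. 5). [cite: CastilloEtAl2024, §2 p. 5] -/
theorem U_mulVec_Uinv_mulVec (v : Fin 4 → ℤ) : U *ᵥ (Uinv *ᵥ v) = v := by
  rw [mulVec_mulVec, U_mul_Uinv, one_mulVec]

/-- `U⁻¹ (U v) = v` (`U` is an automorphism of `M`, source p. 5). [cite: CastilloEtAl2024, §2 p. 5] -/
theorem Uinv_mulVec_U_mulVec (v : Fin 4 → ℤ) : Uinv *ᵥ (U *ᵥ v) = v := by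
  rw [mulVec_mulVec, Uinv_mul_U, one_mulVec]

/-- The table of p. 5, verbatim: `U(h₁) = h₆ − h₅`, `U(h₂) = h₄ − h₂`, `U(h₃) = h₄ − h₅`, `U(h₄) = h₁`,
`U(h₅) = h₆ − h₃`, `U(h₆) = h₄ − h₃`, `U(h₇) = h₇ − h₂` («`U` induces a bijection from `𝓗(S)` to `H`»). [cite: CastilloEtAl2024, §2 p. 5] -/
theorem U_mulVec_h : ∀ g : Fin 7,
    U *ᵥ h g = ![h 5 - h 4, h 3 - h 1, h 3 - h 4, h 0, h 5 - h 2, h 3 - h 2, h 6 - h 1] g := by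
  decide

/-- `U(S) = {m : U⁻¹ m ∈ S}` (`U` is a lattice automorphism, source p. 5). [cite: CastilloEtAl2024, §2 p. 5] -/
theorem mem_map_U_iff (m : Fin 4 → ℤ) : m ∈ S.map (Matrix.mulVecLin U) ↔ Uinv *ᵥ m ∈ S := by
  constructor
  · rintro ⟨x, hx, rfl⟩
    rw [Matrix.mulVecLin_apply, Uinv_mulVec_U_mulVec]
    exact hx
  · intro hm
    exact ⟨Uinv *ᵥ m, hm, by rw [Matrix.mulVecLin_apply, U_mulVec_Uinv_mulVec]⟩

/-! ## §2 Lemma 2: `S = ℕ⟨h₁, …, h₇⟩` -/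

/-- A vector with an explicit non-negative representation on `h₁, …, h₇` lies in the semigroup they generate (the
four component equations spell out `m = Σ xᵢ hᵢ`); plumbing for Lemma 2. [folklore] -/
private theorem mem_closure_of_repr (m : Fin 4 → ℤ) (x₁ x₂ x₃ x₄ x₅ x₆ x₇ : ℤ) (p₁ : 0 ≤ x₁) (p₂ : 0 ≤ x₂) (p₃ : 0 ≤ x₃)
    (p₄ : 0 ≤ x₄) (p₅ : 0 ≤ x₅) (p₆ : 0 ≤ x₆) (p₇ : 0 ≤ x₇) (e₀ : m 0 = x₁ + 2 * x₅ + x₆ + x₇)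
    (e₁ : m 1 = x₂ + 3 * x₅ + 3 * x₆ + 2 * x₇) (e₂ : m 2 = x₃ - 2 * x₅ - x₆ - x₇) (e₃ : m 3 = x₄ - x₅ - x₆) :
    m ∈ AddSubmonoid.closure (Set.range h) := by
  have hm : m = x₁ • h 0 + x₂ • h 1 + x₃ • h 2 + x₄ • h 3 + x₅ • h 4 + x₆ • h 5 + x₇ • h 6 := by
    funext k
    fin_cases k <;> simp [h] <;> omega
  have hz : ∀ (x : ℤ), 0 ≤ x → ∀ g : Fin 7, x • h g ∈ AddSubmonoid.closure (Set.range h) := by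
    intro x hx g
    obtain ⟨n, rfl⟩ := Int.eq_ofNat_of_zero_le hx
    rw [natCast_zsmul]
    exact AddSubmonoid.nsmul_mem _ (AddSubmonoid.subset_closure (Set.mem_range_self g)) n
  rw [hm]
  exact add_mem (add_mem (add_mem (add_mem (add_mem (add_mem (hz _ p₁ 0) (hz _ p₂ 1)) (hz _ p₃ 2)) (hz _ p₄ 3))
    (hz _ p₅ 4)) (hz _ p₆ 5)) (hz _ p₇ 6)

/-- **Lemma 2 of the source** (p. 5): «The Hilbert basis of `S` is `𝓗(S) = {h₁, h₂, …, h₆, h₇}`, where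
`h₇ = (1, 2, −1, 0)`» — here in the form that matters: `S = ω ∩ ℤ⁴` is GENERATED by `h₁, …, h₇`.  Proof as printed:
the triangulation of the octahedral cone by `σ₁ = ⟨h₁h₂h₃h₄⟩`, `σ₂ = ⟨h₁h₂h₃h₆⟩`, `σ₃ = ⟨h₁h₂h₅h₆⟩` (regular) and
`σ₄ = ⟨h₁h₂h₄h₅⟩` (determinant `2`, extra parallelepiped point `h₇`); in coordinates `m = (a,b,c,d)` these are the
regions `c, d ≥ 0` / `d ≤ 0, d ≤ c` / `2d ≤ c ≤ d` / `c ≤ 0, c ≤ 2d` (the parity of `c` decides whether one `h₇` is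
used), each with an explicit non-negative representation.  (Minimality of the seven generators is not restated.) [cite: CastilloEtAl2024, Lemma 2] -/
theorem S_eq_closure : S = AddSubmonoid.closure (Set.range h) := by
  refine le_antisymm ?_ (AddSubmonoid.closure_le.2 ?_)
  · intro m hm
    rw [mem_S_iff, inCone_iff] at hm
    obtain ⟨ha, hb, had, hac, hbd, hbc⟩ := hm
    by_cases hc : 0 ≤ m 2
    · by_cases hd : 0 ≤ m 3
      · -- σ₁ = ⟨h₁ h₂ h₃ h₄⟩
        exact mem_closure_of_repr m (m 0) (m 1) (m 2) (m 3) 0 0 0 ha hb hc hd le_rfl le_rfl le_rfl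
          (by omega) (by omega) (by omega) (by omega)
      · -- σ₂ = ⟨h₁ h₂ h₃ h₆⟩
        exact mem_closure_of_repr m (m 0 + m 3) (m 1 + 3 * m 3) (m 2 - m 3) 0 0 (-m 3) 0 had hbd (by omega)
          le_rfl le_rfl (by omega) le_rfl (by omega) (by omega) (by omega) (by omega)
    · by_cases hd : m 3 ≤ m 2
      · -- σ₂ again (`d ≤ c < 0`)
        exact mem_closure_of_repr m (m 0 + m 3) (m 1 + 3 * m 3) (m 2 - m 3) 0 0 (-m 3) 0 had hbd (by omega)
          le_rfl le_rfl (by omega) le_rfl (by omega) (by omega) (by omega) (by omega)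
      · by_cases hcd : 2 * m 3 ≤ m 2
        · -- σ₃ = ⟨h₁ h₂ h₅ h₆⟩
          exact mem_closure_of_repr m (m 0 + m 2) (m 1 + 3 * m 3) 0 0 (m 3 - m 2) (m 2 - 2 * m 3) 0 hac hbd
            le_rfl le_rfl (by omega) (by omega) le_rfl (by omega) (by omega) (by omega) (by omega)
        · -- σ₄ = ⟨h₁ h₂ h₄ h₅⟩, `det = 2`: parity of `c`
          by_cases hpar : m 2 % 2 = 0
          · exact mem_closure_of_repr m (m 0 + m 2) (m 1 + 3 * (m 2 / 2)) 0 (m 3 - m 2 / 2) (-(m 2 / 2)) 0 0 hac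
              (by omega) le_rfl (by omega) (by omega) le_rfl le_rfl (by omega) (by omega) (by omega) (by omega)
          · exact mem_closure_of_repr m (m 0 + m 2) (m 1 + 3 * (m 2 / 2) + 1) 0 (m 3 - m 2 / 2 - 1)
              (-(m 2 / 2) - 1) 0 1 hac (by omega) le_rfl (by omega) (by omega) le_rfl zero_le_one (by omega)
              (by omega) (by omega) (by omega)
  · rintro _ ⟨g, rfl⟩
    exact h_mem_S g

/-! ## §3 Determinants (source p. 5, display (4)) -/

/-- The chart `A = {h₁, h₂, h₃, h₅}` of the Nash blow-up (source p. 5), as an ordered `4`-tuple of indices into `h`. [cite: CastilloEtAl2024, §2 p. 5] -/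
def chartA : Fin 4 → Fin 7 := ![0, 1, 2, 4]

/-- The `4 × 4` integer matrix with the given four COLUMNS. [folklore] -/
def colMatrix (v : Fin 4 → Fin 4 → ℤ) : Matrix (Fin 4) (Fin 4) ℤ := Matrix.of fun i j => v j i

/-- `det(h₁ h₂ h₃ h₅) = −1` (source p. 5: «Notice that `det₀(h₁,h₂,h₃,h₅) = −1`»). [cite: CastilloEtAl2024, §2 p. 5] -/
theorem det_chartA : (colMatrix fun k => h (chartA k)).det = -1 := by decide

/-- The determinant `det(g, A ∖ hᵢ)` of display (4): the element `h (chartA i)` of `A` is omitted and `h g` is put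
FIRST, the remaining three elements of `A` keep their order (the source's convention «at the beginning of each line
we show the element of `A` that is omitted»). [cite: CastilloEtAl2024, §2 p. 5, (4)] -/
def omitDet (i : Fin 4) (g : Fin 7) : ℤ :=
  (colMatrix (Fin.cons (h g) fun k : Fin 3 => h (chartA (i.succAbove k)))).det

/-- Display (4) of the source, verbatim — rows: `h₁, h₂, h₃, h₅` omitted; columns: `g = h₄, h₆, h₇`:
`det(h₄,h₂,h₃,h₅) = −2, det(h₆,h₂,h₃,h₅) = 1, det(h₇,h₂,h₃,h₅) = −1; det(h₄,h₁,h₃,h₅) = 3, det(h₆,h₁,h₃,h₅) = 0,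
det(h₇,h₁,h₃,h₅) = 2; det(h₄,h₁,h₂,h₅) = 2, det(h₆,h₁,h₂,h₅) = −1, det(h₇,h₁,h₂,h₅) = 1; det(h₄,h₁,h₂,h₃) = −1,
det(h₆,h₁,h₂,h₃) = 1, det(h₇,h₁,h₂,h₃) = 0`. [cite: CastilloEtAl2024, §2 p. 5, (4)] -/
theorem omitDet_table : ∀ i : Fin 4, ∀ t : Fin 3,
    omitDet i (![3, 5, 6] t) = ![![-2, 1, -1], ![3, 0, 2], ![2, -1, 1], ![-1, 1, 0]] i t := by
  decide

/-- All the determinants `det(g, A ∖ hᵢ)` have absolute value `≤ 3`; hence `det_p = 0 ⟺ det = 0` as soon as `p = 0`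
or `p ≥ 5` — the source's «`det_p(h_{i₁}…h_{i₄}) = 0` if and only if `det_0(…) = 0`» for `p ≠ 2, 3` (p. 6). [cite: CastilloEtAl2024, §2 p. 6] -/
theorem abs_omitDet_le (i : Fin 4) (g : Fin 7) : |omitDet i g| ≤ 3 := by
  rw [abs_le]; revert i g; decide

/-- For `p = 0` or `p ≥ 5`, an integer of absolute value `≤ 3` vanishes in `ZMod p` iff it is `0` — this is how
«`det_p(h_{i₁}…h_{i₄}) = 0` if and only if `det_0(…) = 0`» for `p ∉ {2, 3}` (source p. 6) enters. [cite: CastilloEtAl2024, §2 p. 6] -/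
theorem intCast_zmod_ne_zero_iff {p : ℕ} (hp : p = 0 ∨ 5 ≤ p) {z : ℤ} (hz : |z| ≤ 3) :
    ((z : ZMod p) ≠ 0) ↔ z ≠ 0 := by
  rw [not_iff_not, ZMod.intCast_zmod_eq_zero_iff_dvd]
  constructor
  · intro hd
    rcases hp with rfl | hp
    · simpa using hd
    · exact Int.eq_zero_of_abs_lt_dvd hd (by omega)
  · rintro rfl
    exact dvd_zero _

/-! ## §4 The Nash chart `S_A` IS `U(S)` -/

/-- The generators of the Nash-blow-up chart semigroup `S_A` in characteristic `p` (`p = 0` allowed), after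
González–Teissier and Duarte–Jeffries–Núñez-Betancourt as recalled on p. 4 of the source: all of `𝓗(S)`, and the
differences `g − hᵢ` for `hᵢ ∈ A`, `g ∈ 𝓗(S) ∖ A` with `det_p(g, A ∖ hᵢ) ≠ 0` (determinant read in `ZMod p`). [cite: CastilloEtAl2024, §1 p. 4] -/
def nashChartGens (p : ℕ) : Set (Fin 4 → ℤ) :=
  Set.range h ∪ {v | ∃ i : Fin 4, ∃ g : Fin 7, g ∉ Set.range chartA ∧ ((omitDet i g : ℤ) : ZMod p) ≠ 0 ∧
    v = h g - h (chartA i)}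

/-- Finite check behind `⊆`: every Hilbert-basis vector pulls back into `ω` under `U⁻¹` (part of the source's
«straightforward verification», p. 5). [cite: CastilloEtAl2024, §2 p. 5] -/
theorem inCone_Uinv_h : ∀ g : Fin 7, InCone (Uinv *ᵥ h g) := by
  unfold InCone; decide

/-- Finite check behind `⊆`: every admissible difference `g − hᵢ` (`det ≠ 0`) pulls back into `ω` under `U⁻¹` (the
source's ten identities «`h₄ = (h₄−h₃)+h₃, …, h₇−h₁ = (h₆−h₃)+(h₆−h₅)+(h₄−h₂)`», p. 5, in invariant form). [cite: CastilloEtAl2024, §2 p. 5] -/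
theorem inCone_Uinv_diff : ∀ i : Fin 4, ∀ g : Fin 7, omitDet i g ≠ 0 → InCone (Uinv *ᵥ (h g - h (chartA i))) := by
  unfold InCone; decide

/-- Finite check behind `⊇`: each `U(h_g)` is a Nash-chart generator — `h₁`, or a difference `g′ − hᵢ` with
`g′ ∉ A` and `det(g′, A ∖ hᵢ) ≠ 0` (the table `U_mulVec_h` read against display (4): «`U` induces a bijection from
`𝓗(S)` to `H`», p. 5). [cite: CastilloEtAl2024, §2 p. 5] -/
theorem U_mulVec_h_cases : ∀ g : Fin 7, U *ᵥ h g = h 0 ∨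
    ∃ i : Fin 4, ∃ g' : Fin 7, g' ∉ Set.range chartA ∧ omitDet i g' ≠ 0 ∧ U *ᵥ h g = h g' - h (chartA i) := by
  decide

/-- **THE LOOP (Nash blow-up chart — Main Theorem (i), and the chart computation behind (ii) for `p ≥ 5`).**  For
`p = 0` or `p ≥ 5` the semigroup `S_A` generated by the Nash-chart generators at `A = {h₁,h₂,h₃,h₅}` is EXACTLY
`U(S)`: «This yields that `S_A` is isomorphic to `S`. Since `S` is pointed, the same holds for `S_A` and so
`X(S_A) ≅ X(S)` is a covering chart of the Nash blow up of `X(S)`» (source p. 5).  Proof: `⊆` — every generator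
pulls back into `ω ∩ ℤ⁴ = S` under `U⁻¹` (finite check); `⊇` — `S = ℕ⟨h₁,…,h₇⟩` (Lemma 2) and each `U(hᵢ)` is a
generator (the table of p. 5, determinants from display (4), non-zero mod `p` since `|det| ≤ 3 < 5 ≤ p`). [cite: CastilloEtAl2024, Main Theorem (i) / §2 p. 5] -/
theorem closure_nashChartGens_eq_map (p : ℕ) (hp : p = 0 ∨ 5 ≤ p) :
    AddSubmonoid.closure (nashChartGens p) = S.map (Matrix.mulVecLin U) := by
  refine le_antisymm (AddSubmonoid.closure_le.2 ?_) ?_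
  · rintro v (⟨g, rfl⟩ | ⟨i, g, -, hd, rfl⟩)
    · exact (mem_map_U_iff _).2 (inCone_Uinv_h g)
    · refine (mem_map_U_iff _).2 (inCone_Uinv_diff i g ?_)
      rintro h0
      exact hd (by rw [h0]; simp)
  · rw [S_eq_closure, AddSubmonoid.map_le_iff_le_comap, AddSubmonoid.closure_le]
    rintro _ ⟨g, rfl⟩
    rw [SetLike.mem_coe, AddSubmonoid.mem_comap, Matrix.mulVecLin_apply]
    refine AddSubmonoid.subset_closure ?_
    rcases U_mulVec_h_cases g with h0 | ⟨i, g', hg', hd, he⟩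
    · exact Or.inl ⟨0, h0.symm⟩
    · exact Or.inr ⟨i, g', hg', (intCast_zmod_ne_zero_iff hp (abs_omitDet_le i g')).2 hd, he⟩

/-- The six functionals cutting out the cone `Uω`: `τ_j = U^{−T} n_j` — `(0,2,1,2), (0,2,0,3), (1,2,2,2), (0,1,1,1),
(3,2,3,3), (0,1,0,3)`, the rays of the normal cone `τ` of `𝒩_0(S)` at the loop vertex (res-L0-w44-tri-2 KC-NASH v1.1
§2, recomputed here). [folklore] -/
def tauNormal : Fin 6 → Fin 4 → ℤ :=
  ![![0, 2, 1, 2], ![0, 2, 0, 3], ![1, 2, 2, 2], ![0, 1, 1, 1], ![3, 2, 3, 3], ![0, 1, 0, 3]]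

/-- `τ_j = n_j · U⁻¹` (row vector times matrix), i.e. `τ = U^{−T} σ` for the source's automorphism `U` (computed). [cite: CastilloEtAl2024, §2 p. 5] -/
theorem tauNormal_eq : ∀ j : Fin 6, tauNormal j = facetNormal j ᵥ* Uinv := by decide

/-- **`U(S)` is saturated: it is the set of ALL lattice points of the cone `Uω = {x : ⟨τ_j, x⟩ ≥ 0, j = 1…6}`.**
(So any family of vectors of `U(S)` that generates `U(S)` as a semigroup — e.g. the Nash-chart generators above, or the
polyhedron edge directions of the sequel file — spans a real cone whose lattice points are again exactly `U(S)`.)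
This is the source's «since we started with a normal variety `X(S)` … the isomorphic chart `X(S_A)` is also normal»
(p. 5): normal = saturated. [cite: CastilloEtAl2024, §2 p. 5] -/
theorem mem_map_U_iff_tau (m : Fin 4 → ℤ) :
    m ∈ S.map (Matrix.mulVecLin U) ↔ ∀ j : Fin 6, 0 ≤ tauNormal j ⬝ᵥ m := by
  rw [mem_map_U_iff, mem_S_iff, InCone]
  refine forall_congr' fun j => ?_
  rw [tauNormal_eq, ← dotProduct_mulVec]

end CDLAL

end Literature.AlgebraicGeometry.Resolution
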